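import Summits.Ventures.CertifiedManyBodySolver.HubbardAlg.SdaDualEdge
import Summits.Ventures.CertifiedManyBodySolver.Rows.RectMarginalNodesTW
import HarnessLib

/-!
# SDA dual certificates, part 2 — TERM-WISE-RELOCATED stationarity rows ⇒ `LTIRectGSNodeTW` (weak duality)

HONEST FRAMING: first certified bounds; not a superconductivity verdict; every number certified-of-record or labelled
FLOAT.  SOUNDNESS statements only; no number is certified in this module.

Part 1 (`HubbardAlg/SdaDualEdge.lean`) typed the Lagrangian dual cones `LTIRectDual` / `LTIRectGSDual` of the window-marginal
nodes `LTIRectNode` / `LTIRectGSNode` and the weak-duality edges.  Its EOM multipliers `δ · Γ(Λ⁺ ↪ W)([H_{Λ⁺}, Ã])` need the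
whole thickened support `Λ⁺ = thicken Λ 1 ⊆ W` (for `W = 3×3`: `Λ` = the centre site only).  The SDA engine's stationarity
rows (hubbard-algo-p3 `sda13`, token `eom`: `D = Σ_b τ_{v_b}[h_b, W']`) are RELOCATED TERM BY TERM, exactly as the tree's
`TWDatum` relocates the stability observable (module `Rows/RectMarginalNodesTW`, node `LTIRectGSNodeTW`, soundness
`LTIRectGSNodeTW.le_energyDensity2D` PROVED).  This module types:

* §1 `TWPolarDatum t U W Λ A` — ONE family of supports `S_k ⊆ Λ⁺` with translates `S_k + v_k ⊆ W` carrying BOTH the pieces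
  `B_k` of the stability observable `Ãᴴ[H_{Λ⁺}, Ã]` and the pieces `C_k` of the commutator `[H_{Λ⁺}, Ã]` (the engine's natural
  datum: one index per Hamiltonian term meeting `Λ`); `polarise c` = the `TWDatum` of `A + c·1` with pieces `B_k + c̄ C_k`
  (`stabilityObs_add_smul_one`); the relocated operators `stabOp` / `commOp`; and POLARISATION: if every relocated stability
  row of `A + c·1` is nonnegative then the relocated commutator row VANISHES (`trace_commOp_eq_zero`).
* §2 the dual cone `LTIRectGSDualTW t U a b n E` of `LTIRectGSNodeTW` with generators: everything in `LTIRectDual`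
  (`gsDualTW`), everything in `LTIRectGSDual` (`LTIRectGSDual.gsDualTW`, via the trivial datum), the `S^z` multipliers,
  relocated stability multipliers `γ · D.op` (`γ ≥ 0`, any `TWDatum D`), relocated EOM multipliers `δ · P.commOp` (ANY
  `δ ∈ ℂ`, any `TWPolarDatum P`) — closed under `+`, nonnegative scalars, finite sums.
* §3 the EDGE `ltiRectGSNodeTW_of_dualCert`: weighted cluster Hamiltonian `Γ(R ↪ W) h(R; J, V, μ')` (`Σ_∥ J = 1` per
  direction, `Σ V = 1`, free `μ'`) minus a dual element minus `c·1` PSD ⇒ `LTIRectGSNodeTW t U a b n (c − (Σμ')·n)`; and its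
  transport `energyDensity2D_ge_of_dualCertTW` (`U ≥ 0`, `0 ≤ n < 2`), `m3EnergyLowerRow_of_dualCertTW`.

Consequence (the p3 stream's WANTED-7 (ii) in full): every SDA certificate of token class `T2+eom` on an `a × b` window —
in particular the VERIFIED 3×3 certificate of record at `(t,U,n) = (1,8,7/8)`, 1 912 dyadic multipliers, value
`−62912476639/2³⁶ = −0.9154970269` (kit j246781 / j255762: 1 896 transfers of ≤2-body monomials + 16 relocated
stationarity rows) — is, multiplier by multiplier, an element of `LTIRectGSDualTW`, so it becomes a kernel-checked
`M3EnergyLowerRow 0` floor modulo ONE PSD claim node (the 4⁹-dimensional block-diagonal cluster matrix) and the reassembly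
identities `sumB_eq` / `sumC_eq` of its 16 polar data (operator identities in `𝔄_{Λ⁺}` that follow structurally from
`FermionInteraction.localHamiltonian = Σ_X Γ(Φ X)`), with no appeal to the optimiser that found the multipliers.

References: weak duality for conic programs [cite: KullEtAl2024, §II.B]; local stability of ground states
[cite: BratteliRobinsonII1997, Prop. 5.3.25]; cluster lower bounds [cite: ValentiStolzeHirschfeld1991].
-/

noncomputable section

open Matrix Complex Finset
open scoped ComplexOrder MatrixOrder BigOperators
open Literature.Probability.LatticeModels
open Literature.MathematicalPhysics.QuantumLattice
open Literature.MathematicalPhysics.QuantumLattice.AndersonCluster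
open Literature.MathematicalPhysics.QuantumLattice.HubbardWave0
open Literature.MathematicalPhysics.QuantumLattice.ThermodynamicLimit
open Summit.Ventures.CertifiedManyBodySolver.Rows.RectMarginalNodes

namespace Summit.Ventures.CertifiedManyBodySolver.HubbardAlg.SdaDualEdge

/-! ## §1  Relocated operators, polar data, polarisation -/

section Relocated

variable {t U : ℝ} {W Λ : Finset (Site 2)} {A : FermionOp Λ}

/-- An abstract polarisation lemma: `0 ≤ r + c̄ z` for every `c ∈ ℂ` forces `z = 0`. -/
theorem eq_zero_of_forall_nonneg_add_star_mul {r z : ℂ} (key : ∀ c : ℂ, 0 ≤ r + star c * z) : z = 0 := by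
  by_contra hne
  have hpos : 0 < Complex.normSq z := Complex.normSq_pos.2 hne
  have h1 := key (-(((((r.re + 1) / Complex.normSq z : ℝ)) : ℂ) * z))
  have h2 : star (-(((((r.re + 1) / Complex.normSq z : ℝ)) : ℂ) * z)) * z =
      -((((r.re + 1) / Complex.normSq z * Complex.normSq z : ℝ)) : ℂ) := by
    rw [star_neg, star_mul', Complex.star_def, Complex.conj_ofReal, neg_mul, mul_assoc,
      ← Complex.normSq_eq_conj_mul_self, ← Complex.ofReal_mul]
  rw [h2, div_mul_cancel₀ _ hpos.ne'] at h1
  have h3 := (Complex.nonneg_iff.1 h1).1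
  rw [Complex.add_re, Complex.neg_re, Complex.ofReal_re] at h3
  linarith

/-- The RELOCATED WINDOW OPERATOR `Σ_k Γ(S_k + v_k ⊆ W)(τ_{v_k} B_k)` of a translation datum (its row is `Tr(ρ_W · op)`). -/
def twOp (D : TWDatum t U W Λ A) : FermionOp W :=
  ∑ k, fermionEmbed ((PolySite.shiftEmb (D.v k) (D.S k)).trans (PolySite.incl (D.hv k))) (D.B k)

/-- `Tr(ρ · twOp D) = D.row ρ`. -/
theorem trace_mul_twOp (D : TWDatum t U W Λ A) (ρ : FermionOp W) : (ρ * twOp D).trace = D.row ρ := by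
  unfold twOp TWDatum.row
  rw [Finset.mul_sum, Matrix.trace_sum]

/-- **The trivial datum** (no relocation): for `Λ⁺ ⊆ W`, one piece = the stability observable itself, translate `0`. -/
def twDatumOfSubset (t U : ℝ) (hΛ : thicken Λ 1 ⊆ W) (A : FermionOp Λ) : TWDatum t U W Λ A where
  m := 1
  S := fun _ => thicken Λ 1
  hS := fun _ => subset_refl _
  B := fun _ => stabilityObs t U Λ A
  v := fun _ => 0
  hv := fun _ x hx => hΛ (by rwa [mem_shiftSet, sub_zero] at hx)
  sum_eq := by rw [Fin.sum_univ_one, PolySite.incl_rfl, fermionEmbed_refl_apply]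

/-- The row of the trivial datum is the plain (un-relocated) stability row. -/
theorem row_twDatumOfSubset (t U : ℝ) (hΛ : thicken Λ 1 ⊆ W) (A : FermionOp Λ) (ρ : FermionOp W) :
    (twDatumOfSubset t U hΛ A).row ρ = (ρ * fermionEmbed (PolySite.incl hΛ) (stabilityObs t U Λ A)).trace := by
  unfold TWDatum.row twDatumOfSubset
  rw [Fin.sum_univ_one]
  dsimp only
  rw [fermionEmbed_congr (φ := (PolySite.shiftEmb 0 (thicken Λ 1)).trans (PolySite.incl _)) (ψ := PolySite.incl hΛ)
    (fun y => Subtype.ext (by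
      rw [Function.Embedding.trans_apply, PolySite.coe_incl, PolySite.coe_shiftEmb, PolySite.coe_incl, add_zero,
        toLex_ofLex]))]

/-- A **POLAR DATUM** for `(Λ, A)` in the window `W`: supports `S_k ⊆ Λ⁺` with translates `S_k + v_k ⊆ W`, pieces `B_k`
reassembling the stability observable `Ãᴴ[H_{Λ⁺}, Ã]` AND pieces `C_k` (same supports) reassembling the commutator
`[H_{Λ⁺}, Ã]`.  (Engine datum: `k` = a Hamiltonian term `h_b` meeting `Λ`, `S_k = Λ ∪ supp b`, `C_k = [h_b, A]`,
`B_k = Aᴴ[h_b, A]`; unused slots may carry zero pieces.)  Both identities are the certificate's obligations. -/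
structure TWPolarDatum (t U : ℝ) (W Λ : Finset (Site 2)) (A : FermionOp Λ) where
  /-- the number of pieces -/
  m : ℕ
  /-- the supports of the pieces -/
  S : Fin m → Finset (Site 2)
  /-- the supports lie in the thickened box -/
  hS : ∀ k, S k ⊆ thicken Λ 1
  /-- the stability pieces -/
  B : ∀ k, FermionOp (S k)
  /-- the commutator pieces -/
  C : ∀ k, FermionOp (S k)
  /-- the relocating translations -/
  v : Fin m → Site 2
  /-- each translated support lies in the window -/
  hv : ∀ k, shiftSet (v k) (S k) ⊆ W
  /-- the stability pieces reassemble to `Ãᴴ[H_{Λ⁺}, Ã]` -/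
  sumB_eq : ∑ k, fermionEmbed (PolySite.incl (hS k)) (B k) = stabilityObs t U Λ A
  /-- the commutator pieces reassemble to `[H_{Λ⁺}, Ã]` -/
  sumC_eq : ∑ k, fermionEmbed (PolySite.incl (hS k)) (C k) = commObs t U Λ A

namespace TWPolarDatum

variable (P : TWPolarDatum t U W Λ A)

/-- The stability part of a polar datum as a translation datum. -/
def toTWDatum : TWDatum t U W Λ A where
  m := P.m
  S := P.S
  hS := P.hS
  B := P.B
  v := P.v
  hv := P.hv
  sum_eq := P.sumB_eq

/-- **Polarised datum**: the translation datum of `A + c·1` with pieces `B_k + c̄ C_k` (by `stabilityObs_add_smul_one`). -/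
def polarise (c : ℂ) : TWDatum t U W Λ (A + c • 1) where
  m := P.m
  S := P.S
  hS := P.hS
  B := fun k => P.B k + star c • P.C k
  v := P.v
  hv := P.hv
  sum_eq := by
    simp only [map_add, map_smul, Finset.sum_add_distrib, ← Finset.smul_sum, P.sumB_eq, P.sumC_eq,
      stabilityObs_add_smul_one]

/-- The relocated stability operator `Σ_k Γ(τ_{v_k} B_k) ∈ 𝔄_W`. -/
def stabOp : FermionOp W :=
  ∑ k, fermionEmbed ((PolySite.shiftEmb (P.v k) (P.S k)).trans (PolySite.incl (P.hv k))) (P.B k)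

/-- The relocated commutator (EOM) operator `Σ_k Γ(τ_{v_k} C_k) ∈ 𝔄_W`. -/
def commOp : FermionOp W :=
  ∑ k, fermionEmbed ((PolySite.shiftEmb (P.v k) (P.S k)).trans (PolySite.incl (P.hv k))) (P.C k)

/-- `twOp P.toTWDatum = P.stabOp`. -/
theorem twOp_toTWDatum : twOp P.toTWDatum = P.stabOp := rfl

/-- The row of the polarised datum: `Tr(ρ · stabOp) + c̄ · Tr(ρ · commOp)`. -/
theorem row_polarise (c : ℂ) (ρ : FermionOp W) :
    (P.polarise c).row ρ = (ρ * P.stabOp).trace + star c * (ρ * P.commOp).trace := by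
  show ∑ k : Fin P.m, (ρ * fermionEmbed ((PolySite.shiftEmb (P.v k) (P.S k)).trans (PolySite.incl (P.hv k)))
      (P.B k + star c • P.C k)).trace = _
  unfold stabOp commOp
  rw [Finset.mul_sum, Finset.mul_sum, Matrix.trace_sum, Matrix.trace_sum, Finset.mul_sum, ← Finset.sum_add_distrib]
  refine Finset.sum_congr rfl fun k _ => ?_
  rw [map_add, map_smul, Matrix.mul_add, Matrix.trace_add, Matrix.mul_smul, Matrix.trace_smul, smul_eq_mul]

/-- **POLARISATION**: if the relocated stability rows of `A + c·1` are nonnegative for every `c ∈ ℂ`, the relocated EOM row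
of `A` vanishes. -/
theorem trace_commOp_eq_zero (ρ : FermionOp W) (h : ∀ c : ℂ, 0 ≤ (P.polarise c).row ρ) :
    (ρ * P.commOp).trace = 0 :=
  eq_zero_of_forall_nonneg_add_star_mul (r := (ρ * P.stabOp).trace) fun c => by rw [← row_polarise]; exact h c

end TWPolarDatum

end Relocated

/-! ## §2  The dual cone of the term-wise node `LTIRectGSNodeTW` and its generators -/

section DualTW

variable (t U : ℝ) (a b : ℕ) (n : ℝ)

/-- **Dual cone of `LTIRectGSNodeTW t U a b n`**: window operators `E` with `Re Tr(ρ_W E) ≥ 0` on every PSD, normalised,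
window-LTI `ρ_W` of density `n` satisfying the `S^z` rows and EVERY term-wise-relocated stability row of every
gauge-invariant local `(Λ, A)`. -/
def LTIRectGSDualTW (E : FermionOp (rectWindow a b)) : Prop :=
  ∀ ρ : FermionOp (rectWindow a b), ρ.PosSemidef → ρ.trace = 1 → WindowLTI ρ →
    ((ρ * totalNumber).trace).re = ((a : ℝ) * b) * n →
    (∀ σ : Fin 2, ((ρ * ∑ y : PolySite (rectWindow a b), numberOp y σ).trace).re = ((a : ℝ) * b) * (n / 2)) →
    (∀ (Λ : Finset (Site 2)) (A : FermionOp Λ), Commute A totalNumber → Commute A HubbardWave0.spinZ →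
        ∀ D : TWDatum t U (rectWindow a b) Λ A, 0 ≤ D.row ρ) →
    0 ≤ ((ρ * E).trace).re

variable {t U a b n}

/-- Every dual element of the LTI node is a dual element of the term-wise node. -/
theorem LTIRectDual.gsDualTW {E : FermionOp (rectWindow a b)} (hE : LTIRectDual a b n E) :
    LTIRectGSDualTW t U a b n E :=
  fun ρ h1 h2 h3 h4 _ _ => hE ρ h1 h2 h3 h4

/-- Every dual element of the plain ground-state-class node is a dual element of the term-wise node (the plain stability
rows are the rows of the trivial data `twDatumOfSubset`). -/
theorem LTIRectGSDual.gsDualTW {E : FermionOp (rectWindow a b)} (hE : LTIRectGSDual t U a b n E) :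
    LTIRectGSDualTW t U a b n E :=
  fun ρ h1 h2 h3 h4 h5 h6 => hE ρ h1 h2 h3 h4 h5 fun Λ hΛ A hN hS => by
    rw [← row_twDatumOfSubset t U hΛ A ρ]
    exact h6 Λ A hN hS _

/-- LTI-null operators (transfer multipliers) are dual elements of the term-wise node. -/
theorem LTIRectGSDualTW.of_isLTINull {T : FermionOp (rectWindow a b)} (hT : IsLTINull T) :
    LTIRectGSDualTW t U a b n T :=
  (LTIRectDual.of_isLTINull hT).gsDualTW

/-- PSD operators (slack) are dual elements of the term-wise node. -/
theorem LTIRectGSDualTW.of_posSemidef {P : FermionOp (rectWindow a b)} (hP : P.PosSemidef) :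
    LTIRectGSDualTW t U a b n P :=
  (LTIRectDual.of_posSemidef hP).gsDualTW

/-- The density multiplier `ν (N_W − a b n · 1)`, `ν ∈ ℝ`. -/
theorem LTIRectGSDualTW.density (ν : ℝ) :
    LTIRectGSDualTW t U a b n ((ν : ℂ) • totalNumber -
      ((ν * ((a : ℝ) * b * n) : ℝ) : ℂ) • (1 : FermionOp (rectWindow a b))) :=
  (LTIRectDual.density ν).gsDualTW

/-- The `S^z` multiplier `ν (N_{W,σ} − a b n/2 · 1)`, `ν ∈ ℝ`. -/
theorem LTIRectGSDualTW.spin (ν : ℝ) (σ : Fin 2) :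
    LTIRectGSDualTW t U a b n ((ν : ℂ) • ∑ y : PolySite (rectWindow a b), numberOp y σ -
      ((ν * ((a : ℝ) * b * (n / 2)) : ℝ) : ℂ) • (1 : FermionOp (rectWindow a b))) :=
  (LTIRectGSDual.spin ν σ).gsDualTW

/-- **Relocated stability multiplier**: `γ · twOp D`, `γ ≥ 0`, for any translation datum of a gauge-invariant `(Λ, A)`. -/
theorem LTIRectGSDualTW.stability {Λ : Finset (Site 2)} {A : FermionOp Λ} (hN : Commute A totalNumber)
    (hS : Commute A HubbardWave0.spinZ) (D : TWDatum t U (rectWindow a b) Λ A) {γ : ℝ} (hγ : 0 ≤ γ) :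
    LTIRectGSDualTW t U a b n ((γ : ℂ) • twOp D) := by
  intro ρ _ _ _ _ _ htw
  rw [Matrix.mul_smul, Matrix.trace_smul, smul_eq_mul, trace_mul_twOp, Complex.mul_re, Complex.ofReal_re,
    Complex.ofReal_im, zero_mul, sub_zero]
  exact mul_nonneg hγ (Complex.nonneg_iff.1 (htw Λ A hN hS D)).1

/-- **Relocated EOM / stationarity multiplier**: `δ · P.commOp` for EVERY `δ ∈ ℂ` and any polar datum of a gauge-invariant
`(Λ, A)` — its row vanishes on feasible points by polarisation (`A + c·1` is gauge-invariant for every `c`). -/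
theorem LTIRectGSDualTW.commutator {Λ : Finset (Site 2)} {A : FermionOp Λ} (hN : Commute A totalNumber)
    (hS : Commute A HubbardWave0.spinZ) (P : TWPolarDatum t U (rectWindow a b) Λ A) (δ : ℂ) :
    LTIRectGSDualTW t U a b n (δ • P.commOp) := by
  intro ρ _ _ _ _ _ htw
  have h0 := P.trace_commOp_eq_zero ρ fun c =>
    htw Λ (A + c • 1) (hN.add_left ((Commute.one_left _).smul_left c))
      (hS.add_left ((Commute.one_left _).smul_left c)) (P.polarise c)
  rw [Matrix.mul_smul, Matrix.trace_smul, h0, smul_zero, Complex.zero_re]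

/-- Closure under addition. -/
theorem LTIRectGSDualTW.add {E E' : FermionOp (rectWindow a b)} (hE : LTIRectGSDualTW t U a b n E)
    (hE' : LTIRectGSDualTW t U a b n E') : LTIRectGSDualTW t U a b n (E + E') := fun ρ h1 h2 h3 h4 h5 h6 => by
  rw [Matrix.mul_add, Matrix.trace_add, Complex.add_re]
  exact add_nonneg (hE ρ h1 h2 h3 h4 h5 h6) (hE' ρ h1 h2 h3 h4 h5 h6)

/-- Closure under nonnegative real scalars. -/
theorem LTIRectGSDualTW.smul_nonneg {E : FermionOp (rectWindow a b)} (hE : LTIRectGSDualTW t U a b n E) {γ : ℝ}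
    (hγ : 0 ≤ γ) : LTIRectGSDualTW t U a b n ((γ : ℂ) • E) := fun ρ h1 h2 h3 h4 h5 h6 => by
  rw [Matrix.mul_smul, Matrix.trace_smul, smul_eq_mul, Complex.mul_re, Complex.ofReal_re, Complex.ofReal_im, zero_mul,
    sub_zero]
  exact mul_nonneg hγ (hE ρ h1 h2 h3 h4 h5 h6)

/-- Closure under finite sums. -/
theorem LTIRectGSDualTW.sum {κ : Type*} (s : Finset κ) {E : κ → FermionOp (rectWindow a b)}
    (hE : ∀ k ∈ s, LTIRectGSDualTW t U a b n (E k)) : LTIRectGSDualTW t U a b n (∑ k ∈ s, E k) :=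
  fun ρ h1 h2 h3 h4 h5 h6 => by
    rw [Finset.mul_sum, Matrix.trace_sum, Complex.re_sum]
    exact Finset.sum_nonneg fun k hk => hE k hk ρ h1 h2 h3 h4 h5 h6

end DualTW

/-! ## §3  The EDGE into `LTIRectGSNodeTW` and its transport -/

section EdgesTW

/-- The pointwise core of every edge: on ONE window density matrix satisfying the LTI rows and the density row, a PSD
certificate `Γ(R ↪ W) h(R;J,V,μ') − E − c·1 ⪰ 0` with `Re Tr(ρ E) ≥ 0` gives `c − (Σμ')·n ≤ Re Tr(ρ · h_avg)`. -/
theorem re_trace_hAvg_ge_of_cert (t U n : ℝ) {a b : ℕ} (ha : 2 ≤ a) (hb : 2 ≤ b) (R : Finset (Site 2))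
    (hR : R ⊆ rectWindow a b) (J : Site 2 → Fin 2 → ℝ) (V μ : Site 2 → ℝ) (hJ0 : bondWeightSum R J 0 = 1)
    (hJ1 : bondWeightSum R J 1 = 1) (hV : siteWeightSum R V = 1) {E : FermionOp (rectWindow a b)} {c : ℝ}
    (hK : (fermionEmbed (PolySite.incl hR) (clusterHamiltonian R t U J V μ) - E -
      (c : ℂ) • (1 : FermionOp (rectWindow a b))).PosSemidef)
    {ρ : FermionOp (rectWindow a b)} (hpsd : ρ.PosSemidef) (htr : ρ.trace = 1) (hlti : WindowLTI ρ)
    (hdens : ((ρ * totalNumber).trace).re = ((a : ℝ) * b) * n) (hEv : 0 ≤ ((ρ * E).trace).re) :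
    c - siteWeightSum R μ * n ≤ ((ρ * hAvg t U a b).trace).re := by
  have hW := pair_subset_rectWindow ha hb
  have hpos := Literature.LinearAlgebra.Matrix.re_trace_mul_nonneg_of_posSemidef hpsd hK
  have hval : (ρ * (fermionEmbed (PolySite.incl hR) (clusterHamiltonian R t U J V μ) - E -
      (c : ℂ) • (1 : FermionOp (rectWindow a b)))).trace =
      wfun ρ hR (clusterHamiltonian R t U J V μ) - (ρ * E).trace - c := by
    rw [Matrix.mul_sub, Matrix.mul_sub, Matrix.trace_sub, Matrix.trace_sub, Matrix.mul_smul, Matrix.trace_smul,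
      Matrix.mul_one, htr, smul_eq_mul, mul_one, wfun_apply]
  rw [hval, hlti.wfun_clusterHamiltonian t U hW hR, hV, Fin.sum_univ_two, hJ0, hJ1] at hpos
  rw [trace_mul_eq_wfun, hAvg, hlti.wfun_clusterHamiltonian t U hW (subset_refl _), Fin.sum_univ_two,
    bondWeightSum_avgBond_zero ha (by omega), bondWeightSum_avgBond_one (by omega) hb,
    siteWeightSum_avgSite (by omega) (by omega), siteWeightSum_zero]
  rw [hlti.trace_mul_totalNumber hW] at hdens
  have hcard := card_rectWindow' a b
  have hab : (0 : ℝ) < (a : ℝ) * b := by positivity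
  have hd : (wDens ρ hW).re = n := by
    simp only [Complex.mul_re, Complex.natCast_re, Complex.natCast_im, zero_mul, sub_zero, hcard] at hdens
    exact mul_left_cancel₀ hab.ne' hdens
  simp only [Complex.add_re, Complex.sub_re, Complex.mul_re, Complex.ofReal_re, Complex.ofReal_im, zero_mul,
    sub_zero, one_mul, hd] at hpos ⊢
  linarith

/-- **EDGE E3 (SDA class T2 + relocated EOM ⇒ `LTIRectGSNodeTW`)**: `R ⊆ [0,a) × [0,b)` (`a,b ≥ 2`), bond weights
`Σ_{∥e_0} J = Σ_{∥e_1} J = 1`, interaction weights `Σ V = 1`, free potentials `μ'`, a dual element `E` of the term-wise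
node and `Γ(R ↪ W) h(R;J,V,μ') − E − c·1 ⪰ 0` give `LTIRectGSNodeTW t U a b n (c − (Σμ')·n)` — every real `U`, every `n`. -/
theorem ltiRectGSNodeTW_of_dualCert (t U n : ℝ) {a b : ℕ} (ha : 2 ≤ a) (hb : 2 ≤ b) (R : Finset (Site 2))
    (hR : R ⊆ rectWindow a b) (J : Site 2 → Fin 2 → ℝ) (V μ : Site 2 → ℝ) (hJ0 : bondWeightSum R J 0 = 1)
    (hJ1 : bondWeightSum R J 1 = 1) (hV : siteWeightSum R V = 1) {E : FermionOp (rectWindow a b)}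
    (hE : LTIRectGSDualTW t U a b n E) {c : ℝ}
    (hK : (fermionEmbed (PolySite.incl hR) (clusterHamiltonian R t U J V μ) - E -
      (c : ℂ) • (1 : FermionOp (rectWindow a b))).PosSemidef) :
    LTIRectGSNodeTW t U a b n (c - siteWeightSum R μ * n) :=
  fun ρ hpsd htr hlti hdens hspin htw =>
    re_trace_hAvg_ge_of_cert t U n ha hb R hR J V μ hJ0 hJ1 hV hK hpsd htr hlti hdens
      (hE ρ hpsd htr hlti hdens hspin htw)

/-- E3 transported: a dual certificate of the term-wise node is a lower bound on `e(t,U,n)` (`U ≥ 0`, `0 ≤ n < 2`). -/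
theorem energyDensity2D_ge_of_dualCertTW (t : ℝ) {U : ℝ} (hU : 0 ≤ U) {n : ℝ} (hn0 : 0 ≤ n) (hn2 : n < 2)
    {a b : ℕ} (ha : 2 ≤ a) (hb : 2 ≤ b) (R : Finset (Site 2)) (hR : R ⊆ rectWindow a b) (J : Site 2 → Fin 2 → ℝ)
    (V μ : Site 2 → ℝ) (hJ0 : bondWeightSum R J 0 = 1) (hJ1 : bondWeightSum R J 1 = 1) (hV : siteWeightSum R V = 1)
    {E : FermionOp (rectWindow a b)} (hE : LTIRectGSDualTW t U a b n E) {c : ℝ}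
    (hK : (fermionEmbed (PolySite.incl hR) (clusterHamiltonian R t U J V μ) - E -
      (c : ℂ) • (1 : FermionOp (rectWindow a b))).PosSemidef) :
    c - siteWeightSum R μ * n ≤ energyDensity2D t U n :=
  (ltiRectGSNodeTW_of_dualCert t U n ha hb R hR J V μ hJ0 hJ1 hV hE hK).le_energyDensity2D hU ha hb hn0 hn2

/-- **Cell M3 at `t' = 0`**: a dual certificate of the term-wise node at `(t,U,n) = (1,8,7/8)` whose value dominates the
rational slot `lo` is an `M3EnergyLowerRow 0 lo`. -/
theorem m3EnergyLowerRow_of_dualCertTW {a b : ℕ} (ha : 2 ≤ a) (hb : 2 ≤ b) (R : Finset (Site 2))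
    (hR : R ⊆ rectWindow a b) (J : Site 2 → Fin 2 → ℝ) (V μ : Site 2 → ℝ) (hJ0 : bondWeightSum R J 0 = 1)
    (hJ1 : bondWeightSum R J 1 = 1) (hV : siteWeightSum R V = 1) {E : FermionOp (rectWindow a b)}
    (hE : LTIRectGSDualTW 1 8 a b (7 / 8) E) {c : ℝ}
    (hK : (fermionEmbed (PolySite.incl hR) (clusterHamiltonian R 1 8 J V μ) - E -
      (c : ℂ) • (1 : FermionOp (rectWindow a b))).PosSemidef) {lo : ℚ}
    (hlo : (lo : ℝ) ≤ c - siteWeightSum R μ * (7 / 8)) : M3EnergyLowerRow 0 lo :=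
  ((ltiRectGSNodeTW_of_dualCert 1 8 (7 / 8) ha hb R hR J V μ hJ0 hJ1 hV hE hK).mono hlo).m3EnergyLowerRow ha hb

end EdgesTW

end Summit.Ventures.CertifiedManyBodySolver.HubbardAlg.SdaDualEdge

end
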